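import Summits.CriticalPhenomena.PercolationContinuityZ3.Theorems.Transplant.StatementTransitiveGraphConjectures
import Summits.CriticalPhenomena.PercolationContinuityZ3.Theorems.Transplant.SiteContinuityAllDimensions
import HarnessLib

/-!
# Cerf 2026, Conjecture 1.1 — `θ^{site}(p_c, ℤ^d) = 0` for every `d ≥ 3` — CLOSED BY NAME from the tree's site family

builds on p205010 (kernel theorem, internal audit signed; external expert review pending).  Lane `prim-bschramm`, seat `prim-bschramm-gen-5` gen 3, on lead g24's
GO (2026-08-27 #7311) for a LOCATED by-name closure found by the stmt lineage's NODE CENSUS AFTER RUNG Q (stmt-g36, HOME/STATEMENTS.md §5, row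
`Cerf2026_conj_1_1` — marked OPEN there only because no theorem of the tree concluded the node BY NAME; the credit for locating it is the census's).
Helper file (`--supports stmt-CriticalPhenomena-4575 --as helper`); PROOFS ONLY (def-free).

THE POINT.  The conjecture leaf «StatementTransitiveGraphConjectures» types Cerf's Conjecture 1.1 (arXiv:2608.23661v1, §1: "For any `d ≥ 3`, we have
`θ(p_c, ℤ^d) = 0`" for Bernoulli SITE percolation) as `Cerf2026_conj_1_1 : Prop := ∀ d : ℕ, 3 ≤ d → SitePercolationContinuity d`, over the tree's site node
`SitePercolationContinuity d := siteTheta (zdGraph d) 0 (siteCriticalProbI d) = 0` («StatementSite»).  The tree ALREADY proves that node for every `d ≥ 2`: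
`SiteContinuity.sitePercolationContinuity_of_two_le` («SiteContinuityAllDimensions», p226096; `d ≥ 3` by the site Kozma–Nitzan chain
`SiteKN.sitePercolationContinuity_holds` p223368, `d = 2` by the planar chain).  Hence **`cerf2026_conj_1_1_holds : Cerf2026_conj_1_1`** — the printed
conjecture, verbatim as typed, is a theorem of the tree; together with the unfolded form `cerf2026_conj_1_1_unfolded` (`∀ d ≥ 3, θ^{site}_{ℤ^d,0}(p_c^{site}) = 0`).  Nothing here is new mathematics; it is bookkeeping
that connects a typed print conjecture to the theorem that settles it.
[cite: Cerf2026, Conj. 1.1 (§1, p. 1)] [cite: BenjaminiSchramm1996, Conj. 4 and §3] [cite: GrimmettPercolation1999, §1.6]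
-/

noncomputable section

namespace Summit.CriticalPhenomena.PercolationContinuityZ3.Theorems.Transplant

open Literature.Probability.Percolation Literature.Probability.LatticeModels

/-- **Cerf 2026, Conjecture 1.1, HOLDS (by name)**: for every `d ≥ 3`, Bernoulli site percolation on `ℤ^d` has `θ^{site}(p_c^{site}) = 0` at the origin — the
tree's `SiteContinuity.sitePercolationContinuity_of_two_le` (every `d ≥ 2`) restricted to `d ≥ 3`.  builds on p205010 (kernel theorem, internal audit signed;
external expert review pending). [cite: Cerf2026, Conj. 1.1 (§1, p. 1)] [cite: BenjaminiSchramm1996, Conj. 4 and §3] -/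
theorem cerf2026_conj_1_1_holds : Cerf2026_conj_1_1 :=
  fun _ hd => SiteContinuity.sitePercolationContinuity_of_two_le (le_trans (by norm_num) hd)

/-- **Unfolded form**: for every `d ≥ 3`, `θ^{site}_{ℤ^d, 0}(p_c^{site}(ℤ^d)) = 0` in the tree's site vocabulary (`siteTheta`, `siteCriticalProbI`).
builds on p205010 (kernel theorem, internal audit signed; external expert review pending). [cite: Cerf2026, Conj. 1.1 (§1, p. 1)] -/
theorem cerf2026_conj_1_1_unfolded {d : ℕ} (hd : 3 ≤ d) : siteTheta (zdGraph d) (0 : Site d) (siteCriticalProbI d) = 0 :=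
  cerf2026_conj_1_1_holds d hd

end Summit.CriticalPhenomena.PercolationContinuityZ3.Theorems.Transplant

end
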